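import Summits.KontsevichZagierPeriods.Zeta5Search.Denom.DualSeriesBrickOrd
import Summits.KontsevichZagierPeriods.Zeta5Search.Certificates.RecordRayDenominators
import Summits.KontsevichZagierPeriods.Zeta5Search.LaiSaving
import HarnessLib

/-!
# ζ(5) search — the record ray's BRICK CORE: Zudilin's (8.11) saving in the kernel frame (cell `pub-zeta5`, fam-denom 63)

HONEST FRAMING: systematic search; no irrationality claim unless certified.

OUR theorem (Summit side).  The record-ray kernel (`Certificates/RecordRayDenominators*`, typer) removes prime powers
from the baseline multiplier `M0 n = d⁹·N♯(b)·N♯(b′)/|ρ|` (`b = bRecord n`, `b′ = bRecord' n`, `d = d_{41n}`) one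
`θ`-cell at a time: a prime `p` may be divided out `k` times as soon as `p^k` divides BOTH the multiplied wedge
`z_{W′} z_V − z_W z_{V′}` and the multiplied Q-minor `d⁵(z_U z_{W′} − z_{U′} z_W)` (`cell_core`: `k ≤ 9 + v_N + v_N′ + B`
from the atlas of Casoratian zero windows).  This file supplies the SECOND, independent source of such `k`: the
brick exponents of `Denom.DualSeriesBrickOrd` (Zudilin 2004 (8.11), arXiv:math/0206176 §8, for the pair grouping
of Brown–Zudilin (35)).  For every prime `5 < p ≤ 41n < p²` and any `ν ≤ min_i ν(b;i,p)`, `ν′ ≤ min_i ν(b′;i,p)`: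

* `nu_ints`, `nu_ints'` — `ord_p z_U, ord_p z_W, ord_p z_V ≥ ν` and the same for `b′` with `ν′`;
* `brick_wedge` — **`p^k ∣ z_{W′} z_V − z_W z_{V′}`** for `k ≤ ν + ν′`;
* `brick_qminor` — **`p^k ∣ d⁵(z_U z_{W′} − z_{U′} z_W)`** for `k ≤ 5 + ν + ν′`;
* `brick_core` — both at once for `k ≤ ν + ν′`, in exactly the hypothesis/conclusion shape of `RecordRay.cell_core`,
  so that a window of the kernel may take `k = max(k_cell, k_brick)`.

The windows `∀ i ≤ 41n, c ≤ ν(bRecord n; i, p)` for `A·n < p ≤ B·n` are certified separately (`Denom.RecordRayNu*`).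
`p`-adic bookkeeping only; nothing here bears on irrationality.  0 sorry.
-/

noncomputable section

open Finset
open Literature.NumberTheory.Transcendental

namespace Summit.KontsevichZagierPeriods.Zeta5Search

namespace Denom.RecordRayBrickCore

open DualSeries WedgeDictionary DualSeriesDenominators RecordRay Denom.DualSeriesBrickOrd
open DualSeriesLemma19 (bRecord)

/-! ### Small helpers on `PadicOrdGe` -/

-- lane edit (P2 g5): the helper `padicOrdGe_neg` is the tree's `Zeta5Search.padicOrdGe_neg`
-- (`LaiSaving.lean`, imported) — local copy removed on the gate's `dedup.landed` bounce.

/-- Differences. -/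
theorem padicOrdGe_sub {p : ℕ} [Fact p.Prime] {v : ℤ} {q r : ℚ} (hq : PadicOrdGe p v q) (hr : PadicOrdGe p v r) :
    PadicOrdGe p v (q - r) := by
  rw [sub_eq_add_neg]; exact hq.add (padicOrdGe_neg hr)

/-- From `ord_p z ≥ ν ≥ k` (as a rational) to `p^k ∣ z`. -/
theorem int_dvd_of_padicOrdGe {p : ℕ} [Fact p.Prime] {ν : ℤ} {z : ℤ} (h : PadicOrdGe p ν (z : ℚ))
    {k : ℕ} (hk : (k : ℤ) ≤ ν) : (p : ℤ) ^ k ∣ z := by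
  rw [padicValInt_dvd_iff]
  by_cases hz : z = 0
  · exact Or.inl hz
  · right
    rcases h with h | h
    · exact absurd (by exact_mod_cast h) hz
    · rw [padicValRat.of_int] at h
      exact_mod_cast hk.trans h

/-! ### The six integers of the kernel have `ord_p ≥ ν` -/

section Ray

variable {n p : ℕ}

/-- **`ord_p z_U, ord_p z_W, ord_p z_V ≥ ν`** at `b = bRecord n`, for `5 < p ≤ 41n < p²` and `ν ≤ min_{i ≤ 41n} ν(b;i,p)`. -/
theorem nu_ints (hp : p.Prime) (hp5 : 5 < p) (hp41 : p ≤ 41 * n) (hsq : 41 * n < p ^ 2)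
    {ν : ℤ} (hν : ∀ i, i ≤ 41 * n → ν ≤ nuPair (bRecord n) i p) :
    PadicOrdGe p ν (dRec n * sharpNormaliser (bRecord n) * coeffU (bRecord n)) ∧
    PadicOrdGe p ν (dRec n ^ 3 * sharpNormaliser (bRecord n) * coeffW (bRecord n)) ∧
    PadicOrdGe p ν (dRec n ^ 6 * sharpNormaliser (bRecord n) * coeffV (bRecord n)) := by
  haveI := Fact.mk hp
  have h := padicOrdGe_sharp_ints (inBox_bRecord n) (pairs_bRecord n) (sum_bRecord_le n) hp5
    (by rw [bn_bRecord_zero]; exact hp41) (by rw [bn_bRecord_zero]; exact hsq)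
    (ν := ν) (by rw [bn_bRecord_zero]; exact hν)
  rw [bn_bRecord_zero] at h
  exact h

/-- The same at the partner `b′ = bRecord' n` (`n ≥ 1`). -/
theorem nu_ints' (hn : 1 ≤ n) (hp : p.Prime) (hp5 : 5 < p) (hp41 : p ≤ 41 * n) (hsq : 41 * n < p ^ 2)
    {ν' : ℤ} (hν' : ∀ i, i ≤ 41 * n → ν' ≤ nuPair (bRecord' n) i p) :
    PadicOrdGe p ν' (dRec n * sharpNormaliser (bRecord' n) * coeffU (bRecord' n)) ∧
    PadicOrdGe p ν' (dRec n ^ 3 * sharpNormaliser (bRecord' n) * coeffW (bRecord' n)) ∧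
    PadicOrdGe p ν' (dRec n ^ 6 * sharpNormaliser (bRecord' n) * coeffV (bRecord' n)) := by
  haveI := Fact.mk hp
  have h := padicOrdGe_sharp_ints (inBox_bRecord' n) (pairs_bRecord' hn) (sum_bRecord'_le n) hp5
    (by rw [bn_bRecord'_zero]; exact hp41) (by rw [bn_bRecord'_zero]; exact hsq)
    (ν := ν') (by rw [bn_bRecord'_zero]; exact hν')
  rw [bn_bRecord'_zero] at h
  exact h

/-! ### The brick core -/

/-- **`p^k ∣ z_{W′} z_V − z_W z_{V′}`** for `k ≤ ν + ν′`. -/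
theorem brick_wedge (hn : 1 ≤ n) (hp : p.Prime) (hp5 : 5 < p) (hp41 : p ≤ 41 * n) (hsq : 41 * n < p ^ 2)
    {ν ν' : ℤ} (hν : ∀ i, i ≤ 41 * n → ν ≤ nuPair (bRecord n) i p)
    (hν' : ∀ i, i ≤ 41 * n → ν' ≤ nuPair (bRecord' n) i p)
    {k : ℕ} (hk : (k : ℤ) ≤ ν + ν')
    {zW zV zW' zV' : ℤ}
    (hzW : dRec n ^ 3 * sharpNormaliser (bRecord n) * coeffW (bRecord n) = zW)
    (hzV : dRec n ^ 6 * sharpNormaliser (bRecord n) * coeffV (bRecord n) = zV)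
    (hzW' : dRec n ^ 3 * sharpNormaliser (bRecord' n) * coeffW (bRecord' n) = zW')
    (hzV' : dRec n ^ 6 * sharpNormaliser (bRecord' n) * coeffV (bRecord' n) = zV') :
    (p : ℤ) ^ k ∣ (zW' * zV - zW * zV') := by
  haveI := Fact.mk hp
  obtain ⟨-, hW, hV⟩ := nu_ints hp hp5 hp41 hsq hν
  obtain ⟨-, hW', hV'⟩ := nu_ints' hn hp hp5 hp41 hsq hν'
  rw [hzW] at hW; rw [hzV] at hV; rw [hzW'] at hW'; rw [hzV'] at hV'
  have h : PadicOrdGe p (ν + ν') (((zW' * zV - zW * zV' : ℤ) : ℚ)) := by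
    push_cast
    exact padicOrdGe_sub ((hW'.mul hV).mono (by omega)) ((hW.mul hV').mono (by omega))
  exact int_dvd_of_padicOrdGe h hk

/-- **`p^k ∣ d⁵(z_U z_{W′} − z_{U′} z_W)`** for `k ≤ 5 + ν + ν′` (`ord_p d = 1`). -/
theorem brick_qminor (hn : 1 ≤ n) (hp : p.Prime) (hp5 : 5 < p) (hp41 : p ≤ 41 * n) (hsq : 41 * n < p ^ 2)
    {ν ν' : ℤ} (hν : ∀ i, i ≤ 41 * n → ν ≤ nuPair (bRecord n) i p)
    (hν' : ∀ i, i ≤ 41 * n → ν' ≤ nuPair (bRecord' n) i p)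
    {k : ℕ} (hk : (k : ℤ) ≤ 5 + ν + ν')
    {zW zW' zU zU' : ℤ}
    (hzW : dRec n ^ 3 * sharpNormaliser (bRecord n) * coeffW (bRecord n) = zW)
    (hzW' : dRec n ^ 3 * sharpNormaliser (bRecord' n) * coeffW (bRecord' n) = zW')
    (hzU : dRec n * sharpNormaliser (bRecord n) * coeffU (bRecord n) = zU)
    (hzU' : dRec n * sharpNormaliser (bRecord' n) * coeffU (bRecord' n) = zU') :
    (p : ℤ) ^ k ∣ ((Nat.lcmUpto (41 * n) : ℤ) ^ 5 * (zU * zW') - (Nat.lcmUpto (41 * n) : ℤ) ^ 5 * (zU' * zW)) := by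
  haveI := Fact.mk hp
  obtain ⟨hU, hW, -⟩ := nu_ints hp hp5 hp41 hsq hν
  obtain ⟨hU', hW', -⟩ := nu_ints' hn hp hp5 hp41 hsq hν'
  rw [hzW] at hW; rw [hzU] at hU; rw [hzW'] at hW'; rw [hzU'] at hU'
  have hd5 : PadicOrdGe p 5 (((Nat.lcmUpto (41 * n) : ℤ) : ℚ) ^ 5) := by
    refine Or.inr (le_of_eq ?_)
    rw [padicValRat.pow, Int.cast_natCast, padicValRat.of_nat,
      Zudilin2004.padicValNat_lcmUpto_eq_one hp41 hsq]
    simp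
  have h : PadicOrdGe p (5 + ν + ν')
      ((((Nat.lcmUpto (41 * n) : ℤ) ^ 5 * (zU * zW') - (Nat.lcmUpto (41 * n) : ℤ) ^ 5 * (zU' * zW) : ℤ) : ℚ)) := by
    push_cast
    refine padicOrdGe_sub ((hd5.mul (hU.mul hW')).mono (by omega)) ((hd5.mul (hU'.mul hW)).mono (by omega))
  exact int_dvd_of_padicOrdGe h hk

/-- **BRICK CORE** (the shape of `RecordRay.cell_core`).  For a prime `p` with `5 < p ≤ 41n`, `41n < p²`: if
`ν ≤ ν(bRecord n; i, p)` and `ν′ ≤ ν(bRecord' n; i, p)` for all `i ≤ 41n`, and `k ≤ ν + ν′`, then `p^k` divides the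
multiplied wedge `z_{W′}z_V − z_W z_{V′}` and the multiplied Q-minor `d⁵(z_U z_{W′} − z_{U′} z_W)`. -/
theorem brick_core (hn : 1 ≤ n) (hp : p.Prime) (hp5 : 5 < p) (hp41 : p ≤ 41 * n) (hsq : 41 * n < p ^ 2)
    {ν ν' : ℤ} (hν : ∀ i, i ≤ 41 * n → ν ≤ nuPair (bRecord n) i p)
    (hν' : ∀ i, i ≤ 41 * n → ν' ≤ nuPair (bRecord' n) i p)
    {k : ℕ} (hk : (k : ℤ) ≤ ν + ν')
    {zW zV zW' zV' zU zU' : ℤ}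
    (hzW : dRec n ^ 3 * sharpNormaliser (bRecord n) * coeffW (bRecord n) = zW)
    (hzV : dRec n ^ 6 * sharpNormaliser (bRecord n) * coeffV (bRecord n) = zV)
    (hzW' : dRec n ^ 3 * sharpNormaliser (bRecord' n) * coeffW (bRecord' n) = zW')
    (hzV' : dRec n ^ 6 * sharpNormaliser (bRecord' n) * coeffV (bRecord' n) = zV')
    (hzU : dRec n * sharpNormaliser (bRecord n) * coeffU (bRecord n) = zU)
    (hzU' : dRec n * sharpNormaliser (bRecord' n) * coeffU (bRecord' n) = zU') :
    (p : ℤ) ^ k ∣ (zW' * zV - zW * zV') ∧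
    (p : ℤ) ^ k ∣ ((Nat.lcmUpto (41 * n) : ℤ) ^ 5 * (zU * zW') - (Nat.lcmUpto (41 * n) : ℤ) ^ 5 * (zU' * zW)) := by
  exact ⟨brick_wedge hn hp hp5 hp41 hsq hν hν' hk hzW hzV hzW' hzV',
    brick_qminor hn hp hp5 hp41 hsq hν hν' (by omega) hzW hzW' hzU hzU'⟩

end Ray

end Denom.RecordRayBrickCore

end Summit.KontsevichZagierPeriods.Zeta5Search
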